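import Literature.NumberTheory.EllipticCurves.KatoDivisibilitySkeletonProofs
import Literature.NumberTheory.EllipticCurves.IwasawaSelmerIsTorsionProofs
import HarnessLib

/-!
# Kato's divisibility, integral refinement: the algebra of Astérisque 295, §17.13 for Thm. 17.4 (3)

K. Kato, *`p`-adic Hodge theory and values of zeta functions of modular forms*, Astérisque 295
(2004), Thm. 17.4 (p. 273), has three parts; the tree's named fact
`Literature.NumberTheory.EllipticCurves.kato_divisibility` (file `PAdicBSD`) vendors all three for
`T = T_pE(-1)`: (1) `X(E/ℚ_∞)` is `Λ`-torsion; (2) `p^n L_p(E,T) ∈ ι(char_Λ X)` for some `n`;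
(3) under surjectivity of `ρ_{E,p}` (which gives Kato's condition (12.5.2)), `L_p(E,T) ∈ ι(char_Λ X)`.
The sibling file `KatoDivisibilitySkeletonProofs` PROVES the module theory of §17.13 that turns
Kato's four cohomological inputs — the Poitou–Tate sequence (17.13.1), Thm. 12.4, Prop. 17.11 with
Thm. 16.6, and the Euler-system bound Thm. 12.5 (3) at the height-one primes `𝔭 ∌ p` — into
conclusions (1)–(2) (`Kato2004.kato_divisibility_conclusions_of_skeleton`). This file does the
same for conclusion (3), following the first lines of p. 280: "Let `𝔭` be a prime ideal of `Λ`
of height one. In the case `𝔭` contains `p`, we assume `p ≠ 2` and that the condition (12.5.2)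
in 12.5 (4) is satisfied. … By 17.11 and by 12.5, 16.6, we have an isomorphism
`H¹_loc(T(k))_𝔭 / H¹_loc(T'(k))_𝔭 ≅ Λ_𝔭` which sends the image of `Z(f,T)(k)_𝔭` (12.5 (4)) onto
`Λ_𝔭 · L_{p-adic,α,ω,γ}(f)` … Hence `length_{Λ_𝔭}(X(T*(1-k))_𝔭) ≤ length_{Λ_𝔭}(Λ_𝔭/(L_{p-adic}))`",
now at EVERY height-one prime, the Euler-system bound being Thm. 12.5 (4) (p. 222: under `p ≠ 2`
and (12.5.2), `Z(f,T) ⊂ H¹(T)` and `length_{Λ_𝔭}(H²(T)_𝔭) ≤ length_{Λ_𝔭}(H¹(T)_𝔭 / Z(f,T)_𝔭)`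
"for any prime ideal of `Λ` of height one unless `f` and `𝔭` satisfy (12.5.1)", and (12.5.1)
requires `f` not potentially good at `p`, excluded for an elliptic curve with good reduction at `p`).

Everything here is PROVED; the cohomological inputs stay explicit hypotheses on abstract
`Λ`-modules `H` (`= H¹(T(k))`), `P` (`= H¹_loc(T(k))/H¹_loc(T'(k))`), `H2` (`= H²(T(k))`),
`H2loc` (`= H²_loc(T(k))`), exactly as in the sibling file, and no definition or named fact is
introduced (D-0026):

* `Module.mem_charIdeal_of_lengthAt_le` — the bridge at ALL height-one primes: over a Noetherian
  UFD, if a finitely generated torsion module `X` has `length X_𝔭 ≤ length (R/(G))_𝔭` at every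
  height-one prime `𝔭`, then `G ∈ char(X)` (no power of `p` is lost; compare
  `Module.exists_pow_mul_mem_charIdeal_of_lengthAt_le`, which excludes the primes containing `p`
  and concludes `p^m G ∈ char(X)`).
* `Kato2004.mem_charIdeal_of_skeleton_integral` — Thm. 17.4 (3) over `Λ = ℤ_p⟦T⟧` in the tree's
  form: the skeleton of `Kato2004.thm17_4_skeleton` with the Euler-system bound at every
  height-one prime gives `X` torsion and `G ∈ char_Λ X`.
* `Kato2004.kato_divisibility_conclusion3_of_skeleton` — for a Pontryagin-dual datum `D` of
  `Sel_{p^∞}(E/ℚ_∞)`: `∃ g ∈ char_Λ D.X, ι g = L_p(E,T)`, literally conclusion 3 of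
  `kato_divisibility`, from the integral inputs (`G ≠ 0` is again Rohrlich's theorem, a tree theorem).
* `Kato2004.kato_divisibility_body_of_skeleton` — all three conclusions of `kato_divisibility` for
  `D` from the inputs of §17.13: the rational ones of the sibling file for (1)–(2), and, under the
  surjectivity hypothesis of clause 3 (whence (12.5.2): `det ρ_{E,p} = χ_p`, so the image of
  `Gal(ℚ̄/ℚ(ζ_{p^∞}))` is `ρ(Γ_ℚ) ∩ SL₂(ℤ_p) = SL₂(ℤ_p)`), the integral ones of Thm. 12.5 (4).
* `kato_divisibility_of_exists_body` — the body of `kato_divisibility` does not depend on the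
  datum `D` (`SelmerDualData.isTorsion_iff`, `SelmerDualData.charIdeal_eq`: all data have
  `Λ`-isomorphic modules), so establishing it for ONE datum per `(κ, γ)` proves the fact. Composed
  with `kato_divisibility_body_of_skeleton` this is the complete statement of what remains between
  the tree and `kato_divisibility_holds`: Kato's (17.13.1), Thm. 12.4, Prop. 17.11 + Thm. 16.6 and
  Thm. 12.5 (3)–(4) for `T_pE(-1)` on one cyclotomic datum — Iwasawa cohomology, the Perrin-Riou /
  Coleman map and the Beilinson–Kato Euler system, none of which exists in Mathlib or `Literature/`.

References: K. Kato, Astérisque 295 (2004), Thm. 12.5 (3)(4) (p. 222), Thm. 16.6 (p. 271),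
Prop. 17.11 (p. 277), §17.13 (pp. 279–280), Thm. 17.4 (p. 273); K. Rubin, *Euler Systems*, Ann.
Math. Stud. 147, Thm. 2.3.3–2.3.4; L. Washington, *Introduction to Cyclotomic Fields*, §13.2
(characteristic ideals over `Λ`).
-/

noncomputable section

open scoped MatrixGroups ModularForm

open CongruenceSubgroup Literature.NumberTheory.EllipticCurves.ModularForms

namespace Literature.NumberTheory.EllipticCurves

namespace Module

/-! ### The bridge at all height-one primes: `length X_𝔭 ≤ ord_𝔭(G)` for all `𝔭` ⇒ `G ∈ char X` -/

section Bridge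

variable {R : Type*} [CommRing R] [IsDomain R] [IsNoetherianRing R] [UniqueFactorizationMonoid R]
  {X : Type*} [AddCommGroup X] [_root_.Module R X]

/-- **From Kato's printed form of Thm. 17.4 (3) to divisibility in `Λ`.** Let `R` be a Noetherian
UFD, `X` a finitely generated torsion `R`-module and `G ≠ 0`. If
`length_{R_𝔭} X_𝔭 ≤ length_{R_𝔭} (R/(G))_𝔭` for EVERY height-one prime `𝔭`, then `G ∈ char(X)`,
i.e. `char(X) ∣ (G)`. Proof: `char(X)` is the finite product `∏_{𝔭 ∈ S} 𝔭^{n_𝔭}` over the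
height-one support `S` of `X`; each such `𝔭` is `(π_𝔭)` for a prime element `π_𝔭`, so
`char(X) = (∏ π_𝔭^{n_𝔭})`; the hypothesis and `pow_dvd_of_le_lengthAt_quotient` give
`π_𝔭^{n_𝔭} ∣ G`, and these pairwise relatively prime prime powers divide `G` jointly.
(Kato, Astérisque 295, Thm. 17.4 (3), p. 273, states the length inequalities at all height-one
primes; the tree's `kato_divisibility` (3) states `L_p ∈ ι(char_Λ X)`; this lemma is the passage
between them, cf. Washington §13.2.) [folklore] -/
theorem mem_charIdeal_of_lengthAt_le [Module.Finite R X]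
    (hX : Module.IsTorsion R X) {G : R} (hG : G ≠ 0)
    (h : ∀ 𝔭 : PrimeSpectrum R, 𝔭.asIdeal.height = 1 →
      lengthAt R X 𝔭 ≤ lengthAt R (R ⧸ Ideal.span {G}) 𝔭) :
    G ∈ charIdeal R X := by
  classical
  -- one `s ≠ 0` kills the finitely generated torsion module `X`
  obtain ⟨s, hsann, hs0⟩ := Submodule.annihilator_top_inter_nonZeroDivisors hX
  have hs : s ≠ 0 := nonZeroDivisors.ne_zero hs0
  have hsX : Module.IsTorsionBy R X s := fun x =>
    Submodule.mem_annihilator.mp hsann x Submodule.mem_top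
  -- `char X` is a finite product over the height-one support `t`
  set F : PrimeSpectrum R → Ideal R := fun 𝔭 => 𝔭.asIdeal ^ (lengthAt R X 𝔭).toNat with hF
  have hfin := finite_heightOne_inter_mulSupport hs hsX
  set t : Finset (PrimeSpectrum R) := hfin.toFinset with ht
  have hchar : charIdeal R X = ∏ 𝔭 ∈ t, F 𝔭 := by
    unfold charIdeal
    refine finprod_mem_eq_prod_of_inter_mulSupport_eq F ?_
    rw [ht, Set.Finite.coe_toFinset, Set.inter_assoc, Set.inter_self]
  -- every `𝔭 ∈ t` has height one and contains `s`, hence is generated by a prime element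
  have hmem : ∀ 𝔭 ∈ t, 𝔭.asIdeal.height = 1 ∧ s ∈ 𝔭.asIdeal := by
    intro 𝔭 h𝔭
    rw [ht, Set.Finite.mem_toFinset] at h𝔭
    refine ⟨h𝔭.1, ?_⟩
    by_contra hns
    exact h𝔭.2 (by simp [lengthAt_eq_zero_of_isTorsionBy hsX 𝔭 hns])
  have hgen : ∀ 𝔭 ∈ t, ∃ π : R, Prime π ∧ 𝔭.asIdeal = Ideal.span {π} := by
    intro 𝔭 h𝔭
    obtain ⟨h1, hs𝔭⟩ := hmem 𝔭 h𝔭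
    have hne : 𝔭.asIdeal ≠ ⊥ := fun hbot => hs (by rwa [hbot, Ideal.mem_bot] at hs𝔭)
    obtain ⟨π, hπ𝔭, hπ⟩ := Ideal.IsPrime.exists_mem_prime_of_ne_bot 𝔭.isPrime hne
    exact ⟨π, hπ, Ideal.eq_span_singleton_of_height_eq_one h1 hπ𝔭 hπ⟩
  choose! π hπ hπeq using hgen
  set n : PrimeSpectrum R → ℕ := fun 𝔭 => (lengthAt R X 𝔭).toNat with hn
  have hchar' : charIdeal R X = Ideal.span {∏ 𝔭 ∈ t, π 𝔭 ^ n 𝔭} := by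
    rw [hchar, ← Ideal.prod_span_singleton]
    refine Finset.prod_congr rfl fun 𝔭 h𝔭 => ?_
    simp only [F, n]
    rw [hπeq 𝔭 h𝔭, Ideal.span_singleton_pow]
  rw [hchar', Ideal.mem_span_singleton]
  -- the factors are pairwise relatively prime and each divides `G`
  refine Finset.prod_dvd_of_isRelPrime ?_ ?_
  · intro 𝔭 h𝔭 𝔮 h𝔮 hne
    rw [Finset.mem_coe] at h𝔭 h𝔮
    refine isRelPrime_pow_of_not_associated (hπ 𝔭 h𝔭) (hπ 𝔮 h𝔮) (fun hass => hne ?_) _ _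
    exact PrimeSpectrum.ext
      ((hπeq 𝔭 h𝔭).trans ((Ideal.span_singleton_eq_span_singleton.mpr hass).trans
        (hπeq 𝔮 h𝔮).symm))
  · intro 𝔭 h𝔭
    refine pow_dvd_of_le_lengthAt_quotient (hπ 𝔭 h𝔭) hG 𝔭 (hπeq 𝔭 h𝔭) ?_
    -- `n 𝔭 = length X_𝔭 ≤ length (R/G)_𝔭` (the length is finite)
    have hfinlen : lengthAt R X 𝔭 ≠ ⊤ :=
      lengthAt_ne_top_of_isTorsionBy hs hsX 𝔭 (le_of_eq (hmem 𝔭 h𝔭).1)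
    calc ((n 𝔭 : ℕ) : ℕ∞) = lengthAt R X 𝔭 := ENat.coe_toNat hfinlen
      _ ≤ _ := h 𝔭 (hmem 𝔭 h𝔭).1

end Bridge

end Module

namespace Kato2004

open Module

/-! ### Thm. 17.4 (3) over `Λ = ℤ_p⟦T⟧`, in the tree's form -/

section Iwasawa

variable (p : ℕ) [Fact p.Prime]
  {H P X H2 : Type*} [AddCommGroup H] [_root_.Module (IwasawaAlgebra p) H]
  [AddCommGroup P] [_root_.Module (IwasawaAlgebra p) P]
  [AddCommGroup X] [_root_.Module (IwasawaAlgebra p) X]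
  [AddCommGroup H2] [_root_.Module (IwasawaAlgebra p) H2]

/-- **Kato, Thm. 17.4 (3) for `Λ = ℤ_p⟦T⟧`, skeleton.** Hypotheses as in `thm17_4_skeleton`
(`H →loc P →toX X →δ H2` exact at `P` and `X`: (17.13.1); `H` torsion free of rank `≤ 1`, `H2`
torsion: Thm. 12.4; `col : P ↪ Λ` injective: Prop. 17.11; `Z ≤ H` with `G ∈ col (loc Z)`,
`G ≠ 0`: Thm. 16.6 (2) for good `ω`, `γ`), with `X` finitely generated and the Euler-system bound
in its INTEGRAL shape `length H2_𝔭 ≤ length (H/Z)_𝔭` at EVERY height-one prime `𝔭` (Thm. 12.5 (4),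
p. 222, under `p ≠ 2` and (12.5.2), for `f` potentially good at `p`). Conclusion: `X` is
`Λ`-torsion and `G ∈ char_Λ X` — Kato's "`length_{Λ_𝔭}(X_𝔭) ≤ ord_𝔭(L_{p-adic})` for any prime
ideal `𝔭` of `Λ` of height one" (p. 273) in the ideal-theoretic form of the tree (bridge:
`Module.mem_charIdeal_of_lengthAt_le`).
[cite: Kato2004Asterisque, Thm 17.4 (3) (p. 273) and §17.13 (p. 280)] -/
theorem mem_charIdeal_of_skeleton_integral [Module.Finite (IwasawaAlgebra p) X]
    [Module.IsTorsionFree (IwasawaAlgebra p) H] (hrank : Module.rank (IwasawaAlgebra p) H ≤ 1)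
    (loc : H →ₗ[IwasawaAlgebra p] P) (toX : P →ₗ[IwasawaAlgebra p] X)
    (δ : X →ₗ[IwasawaAlgebra p] H2)
    (hPX : Function.Exact loc toX) (hXH : Function.Exact toX δ)
    (col : P →ₗ[IwasawaAlgebra p] IwasawaAlgebra p) (hcol : Function.Injective col)
    (hH2 : Module.IsTorsion (IwasawaAlgebra p) H2)
    (Z : Submodule (IwasawaAlgebra p) H) {G : IwasawaAlgebra p} (hG : G ≠ 0)
    (hGZ : G ∈ Submodule.map (col ∘ₗ loc) Z)
    (hES : ∀ 𝔭 : PrimeSpectrum (IwasawaAlgebra p), 𝔭.asIdeal.height = 1 →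
      lengthAt (IwasawaAlgebra p) H2 𝔭 ≤ lengthAt (IwasawaAlgebra p) (H ⧸ Z) 𝔭) :
    Module.IsTorsion (IwasawaAlgebra p) X ∧ G ∈ charIdeal (IwasawaAlgebra p) X := by
  obtain ⟨htors, hlen⟩ := thm17_4_skeleton hrank loc toX δ hPX hXH col hcol hH2 Z hG hGZ
  exact ⟨htors, mem_charIdeal_of_lengthAt_le htors hG fun 𝔭 h1 => hlen 𝔭 (hES 𝔭 h1)⟩

end Iwasawa

/-! ### For `X = X(E/ℚ_∞)` and `L = L_p(E,T)`: conclusion 3, and all of `kato_divisibility` -/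

section Selmer

variable (W : WeierstrassCurve ℚ) [W.IsElliptic] [W.IsGloballyMinimal] (p : ℕ) [Fact p.Prime]
  {κ : ZpExtension ℚ p} {γ : Field.absoluteGaloisGroup ℚ} {N : ℕ} [NeZero N]
  {f : CuspForm (Gamma0 N) 2}
  {H P H2 H2loc : Type*} [AddCommGroup H] [_root_.Module (IwasawaAlgebra p) H]
  [AddCommGroup P] [_root_.Module (IwasawaAlgebra p) P]
  [AddCommGroup H2] [_root_.Module (IwasawaAlgebra p) H2]
  [AddCommGroup H2loc] [_root_.Module (IwasawaAlgebra p) H2loc]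

/-- **Conclusion 3 of `kato_divisibility` (= Kato Thm. 17.4 (3) for `T_pE`) from the integral
inputs of §17.13.** For `E/ℚ` (globally minimal `W`), `p` good ordinary (`hord`), `f` its newform
(`hf`), `κ` a cyclotomic `ℤ_p`-extension with topological generator `γ` and `D` a Pontryagin-dual
datum for `Sel_{p^∞}(E/ℚ_∞)`: GIVEN `Λ`-modules `H, P, H2` with the Poitou–Tate maps
`H → P → D.X → H2` exact at `P` and `D.X` ((17.13.1)), `H` torsion free of rank `≤ 1` and `H2`
torsion (Thm. 12.4), an injective `col : P → Λ` (Prop. 17.11) and a submodule `Z ≤ H` (the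
INTEGRAL zeta elements `Z(f,T) ⊂ H¹(T)` of Thm. 12.5 (4)) whose image `col (loc Z)` contains `G`
with `ι G = L_p(E,T)` (Thm. 16.6 (2) with good `ω`, `γ`: "`L_{p-adic} ∈ Λ` … follows also from
17.11, 12.5 (4) and 16.6", p. 279), and the Euler-system bound of Thm. 12.5 (4) at every
height-one prime — THEN `L_p(E,T) = ι g` for some `g ∈ char_Λ D.X`. `G ≠ 0` is not assumed:
`L_p(E,T) ≠ 0` is the tree theorem `padicLFunction_unitRoot_ne_zero` (Rohrlich 1984).
[cite: Kato2004Asterisque, Thm 17.4 (3) (p. 273) and §17.13 (pp. 279–280)] -/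
theorem kato_divisibility_conclusion3_of_skeleton (hord : IsOrdinaryAt W p) (hf : IsNewformOf W f)
    (hκ : κ.IsCyclotomic) (hγ : κ.IsTopGenerator γ) (D : W.SelmerDualData κ γ)
    [Module.IsTorsionFree (IwasawaAlgebra p) H] (hrank : Module.rank (IwasawaAlgebra p) H ≤ 1)
    (loc : H →ₗ[IwasawaAlgebra p] P) (toX : P →ₗ[IwasawaAlgebra p] D.X)
    (δ : D.X →ₗ[IwasawaAlgebra p] H2)
    (hPX : Function.Exact loc toX) (hXH : Function.Exact toX δ)
    (col : P →ₗ[IwasawaAlgebra p] IwasawaAlgebra p) (hcol : Function.Injective col)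
    (hH2 : Module.IsTorsion (IwasawaAlgebra p) H2)
    (Z : Submodule (IwasawaAlgebra p) H) {G : IwasawaAlgebra p}
    (hGZ : G ∈ Submodule.map (col ∘ₗ loc) Z)
    (hES : ∀ 𝔭 : PrimeSpectrum (IwasawaAlgebra p), 𝔭.asIdeal.height = 1 →
      lengthAt (IwasawaAlgebra p) H2 𝔭 ≤ lengthAt (IwasawaAlgebra p) (H ⧸ Z) 𝔭)
    (hιG : iwasawaToPowerSeries p G = padicLFunction f (unitRoot W p : ℚ_[p])) :
    ∃ g ∈ D.charIdeal, iwasawaToPowerSeries p g = padicLFunction f (unitRoot W p : ℚ_[p]) := by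
  haveI : Module.Finite (IwasawaAlgebra p) D.X := D.module_finite_of_isCyclotomic W κ hκ hγ
  have hG : G ≠ 0 := by
    intro hG0
    have hL := padicLFunction_unitRoot_ne_zero hord hf
    rw [hG0, map_zero] at hιG
    exact hL hιG.symm
  exact ⟨G, (mem_charIdeal_of_skeleton_integral p hrank loc toX δ hPX hXH col hcol hH2 Z hG hGZ
    hES).2, hιG⟩

/-- **All three conclusions of `kato_divisibility` for a datum `D`, from the cohomological inputs
of Kato's §17.13.** Data and hypotheses as in `kato_divisibility_conclusions_of_skeleton`
(sibling file): the Poitou–Tate maps `H → P → D.X → H2` exact at `P` and `D.X` ((17.13.1) with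
(17.10.1), (17.13.3)), `H` torsion free of rank `≤ 1` and `H2` torsion (Thm. 12.4), `col : P ↪ Λ`
(Prop. 17.11); for conclusions 1–2 a submodule `Z ≤ H` (multiples of the zeta elements lying in
`H¹(T)`) with `G ∈ col (loc Z)`, `ι G = p^n L_p(E,T)` (Thm. 16.6, "`L_{p-adic} ∈ Λ ⊗ ℚ`") and the
Euler-system bound of Thm. 12.5 (3) at the height-one `𝔭 ∌ p`, with its `H2loc`-term vanishing
there (good reduction at `p`); for conclusion 3, AVAILABLE ONLY under the surjectivity hypothesis
of that clause (`ρ̄_{E,p^m}` surjective for all `m`, which implies Kato's (12.5.2) because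
`det ρ_{E,p}` is the cyclotomic character), the integral zeta submodule `Z' ≤ H` of Thm. 12.5 (4)
with `G' ∈ col (loc Z')`, `ι G' = L_p(E,T)` and the bound `length H2_𝔭 ≤ length (H/Z')_𝔭` at
every height-one `𝔭` (Thm. 12.5 (4); (12.5.1) is excluded for good reduction). Conclusion: the
body of `kato_divisibility W p` at `(κ, γ, f, D)`.
[cite: Kato2004Asterisque, Thm 17.4 (p. 273) and §17.13 (pp. 279–280)] -/
theorem kato_divisibility_body_of_skeleton (hord : IsOrdinaryAt W p) (hf : IsNewformOf W f)
    (hκ : κ.IsCyclotomic) (hγ : κ.IsTopGenerator γ) (D : W.SelmerDualData κ γ)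
    [Module.IsTorsionFree (IwasawaAlgebra p) H] (hrank : Module.rank (IwasawaAlgebra p) H ≤ 1)
    (loc : H →ₗ[IwasawaAlgebra p] P) (toX : P →ₗ[IwasawaAlgebra p] D.X)
    (δ : D.X →ₗ[IwasawaAlgebra p] H2)
    (hPX : Function.Exact loc toX) (hXH : Function.Exact toX δ)
    (col : P →ₗ[IwasawaAlgebra p] IwasawaAlgebra p) (hcol : Function.Injective col)
    (hH2 : Module.IsTorsion (IwasawaAlgebra p) H2)
    (Z : Submodule (IwasawaAlgebra p) H) {G : IwasawaAlgebra p}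
    (hGZ : G ∈ Submodule.map (col ∘ₗ loc) Z)
    (hES : ∀ 𝔭 : PrimeSpectrum (IwasawaAlgebra p), 𝔭.asIdeal.height = 1 →
      PowerSeries.C (p : ℤ_[p]) ∉ 𝔭.asIdeal →
        lengthAt (IwasawaAlgebra p) H2 𝔭 ≤
          lengthAt (IwasawaAlgebra p) (H ⧸ Z) 𝔭 + lengthAt (IwasawaAlgebra p) H2loc 𝔭)
    (hH2loc : ∀ 𝔭 : PrimeSpectrum (IwasawaAlgebra p), 𝔭.asIdeal.height = 1 →
      PowerSeries.C (p : ℤ_[p]) ∉ 𝔭.asIdeal → lengthAt (IwasawaAlgebra p) H2loc 𝔭 = 0)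
    {n : ℕ} (hιG : iwasawaToPowerSeries p G =
      PowerSeries.C ((p : ℚ_[p]) ^ n) * padicLFunction f (unitRoot W p : ℚ_[p]))
    (hint : (∀ m : ℕ, W.HasSurjectiveModNGaloisRep (p ^ m : ℕ)) →
      ∃ (Z' : Submodule (IwasawaAlgebra p) H) (G' : IwasawaAlgebra p),
        G' ∈ Submodule.map (col ∘ₗ loc) Z' ∧
        iwasawaToPowerSeries p G' = padicLFunction f (unitRoot W p : ℚ_[p]) ∧
        ∀ 𝔭 : PrimeSpectrum (IwasawaAlgebra p), 𝔭.asIdeal.height = 1 →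
          lengthAt (IwasawaAlgebra p) H2 𝔭 ≤ lengthAt (IwasawaAlgebra p) (H ⧸ Z') 𝔭) :
    D.IsTorsion ∧
    (∃ (n : ℕ) (g : IwasawaAlgebra p), g ∈ D.charIdeal ∧
      iwasawaToPowerSeries p g =
        PowerSeries.C ((p : ℚ_[p]) ^ n) * padicLFunction f (unitRoot W p : ℚ_[p])) ∧
    ((∀ n : ℕ, W.HasSurjectiveModNGaloisRep (p ^ n : ℕ)) →
      ∃ g ∈ D.charIdeal, iwasawaToPowerSeries p g = padicLFunction f (unitRoot W p : ℚ_[p])) := by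
  obtain ⟨htors, h2⟩ := kato_divisibility_conclusions_of_skeleton W p hord hf hκ hγ D hrank loc toX
    δ hPX hXH col hcol hH2 Z hGZ hES hH2loc hιG
  refine ⟨htors, h2, fun hsurj => ?_⟩
  obtain ⟨Z', G', hGZ', hιG', hES'⟩ := hint hsurj
  exact kato_divisibility_conclusion3_of_skeleton W p hord hf hκ hγ D hrank loc toX δ hPX hXH col
    hcol hH2 Z' hGZ' hES' hιG'

end Selmer

end Kato2004

/-! ### The body of `kato_divisibility` does not depend on the datum -/

section Datum

variable (W : WeierstrassCurve ℚ) [W.IsElliptic] [W.IsGloballyMinimal] (p : ℕ) [Fact p.Prime]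
  {κ : ZpExtension ℚ p} {γ : Field.absoluteGaloisGroup ℚ} {N : ℕ} [NeZero N]
  {f : CuspForm (Gamma0 N) 2}

omit [W.IsElliptic] in
/-- **One datum suffices.** The three conclusions of `kato_divisibility` only involve `D.IsTorsion`
and `D.charIdeal`, which do not depend on the Pontryagin-dual datum `D` of `Sel_{p^∞}(E/ℚ_∞)`
(`SelmerDualData.isTorsion_iff`, `SelmerDualData.charIdeal_eq`: any two data have `Λ`-isomorphic
modules, `SelmerDualData.nonempty_linearEquiv_holds`). Hence `kato_divisibility W p` at `(κ, γ, f)`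
follows as soon as, under its six hypotheses, its body holds for SOME datum — e.g. the one on
which Kato's inputs of §17.13 are constructed (`Kato2004.kato_divisibility_body_of_skeleton`).
(Greenberg, LNM 1716, §1, p. 60: the Iwasawa module `X_E(F_∞)` is canonical.)
[cite: Kato2004Asterisque, Thm 17.4 (p. 273)] -/
theorem kato_divisibility_of_exists_body
    (h : ∀ (_hp : p ≠ 2) (_hord : IsOrdinaryAt W p) (_hκ : κ.IsCyclotomic)
      (_hγ : κ.IsTopGenerator γ) (_hγ' : IsCyclotomicVariable p γ) (_hf : IsNewformOf W f),
      ∃ D₀ : W.SelmerDualData κ γ,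
        D₀.IsTorsion ∧
        (∃ (n : ℕ) (g : IwasawaAlgebra p), g ∈ D₀.charIdeal ∧
          iwasawaToPowerSeries p g =
            PowerSeries.C ((p : ℚ_[p]) ^ n) * padicLFunction f (unitRoot W p : ℚ_[p])) ∧
        ((∀ n : ℕ, W.HasSurjectiveModNGaloisRep (p ^ n : ℕ)) →
          ∃ g ∈ D₀.charIdeal,
            iwasawaToPowerSeries p g = padicLFunction f (unitRoot W p : ℚ_[p]))) :
    kato_divisibility W p (κ := κ) (γ := γ) (f := f) := by
  intro hp hord hκ hγ hγ' hf D
  obtain ⟨D₀, h1, h2, h3⟩ := h hp hord hκ hγ hγ' hf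
  rw [D₀.isTorsion_iff D, D₀.charIdeal_eq D] at *
  exact ⟨h1, h2, h3⟩

end Datum

end Literature.NumberTheory.EllipticCurves
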